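import Summits.CriticalPhenomena.PercolationContinuityZ3.Theorems.Transplant.FKConnectivityAllQAntipodalOrAttTPlus
import Summits.CriticalPhenomena.PercolationContinuityZ3.Theorems.Transplant.FKConnectivityAllQAntipodalLevel4

/-!
# Connectivity correlation inequalities for `φ_{w,q}`, every `q > 0` — file 64e: **`T1⁺` AT AN ARBITRARY POSITION** (the `T1` rays of the odd cone,
# root-free form)

Support file (`--supports stmt-CriticalPhenomena-4575`), FK sub-lane `prim-bschramm-fk-2` (gen 29); builds on p205010 (kernel theorem,
internal audit signed; external expert review pending).  No definitions, no named facts, no sorries; standard axioms.  Memo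
FROM-fk-2-g29-BRIDGE.md §14 (master-file plan, rays 13–18).

File 63f (`FK.apPsiC_levels_le_orAttT_nonpos_of_isTTSP`) proves the `q`-free inequality for `f = 1{S₁ ⊆ X ∧ (y ∈ X ∨ z ∈ X)}` with the root
edge `st` inside the conjunction `S₁`.  The level-4 assembly meets the type `T1 = ab·(c ∨ d)` in all placements (root in the AND pair, in the OR
pair, or outside); Duffin re-rooting (`FK.IsTTSP.reroot_erase`) at an edge of `S₁` gives the root-free form
`apPsiCW_orAttTSet_nonpos_of_isTTSP` / `apPsiC_levels_le_orAttTSet_nonpos_of_isTTSP`: any nonempty `S₁ ⊆ H`, any two further edges `y ≠ z`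
of `H`, any cell `N` (free) / `C` (contracted) off them.
[cite: Grimmett2006, §3.8 Thm. (3.90) (pp. 61–62); §3.9 (pp. 63–64)] [cite: Wagner2006, Thm. 5.8(d), §5.3]
-/

noncomputable section

namespace Summit.CriticalPhenomena.PercolationContinuityZ3.Theorems

namespace FK

open SimpleGraph Literature.Probability.LatticeModels Literature.Probability.Percolation
open scoped Classical

variable {V : Type*} [Fintype V]

/-- **`T1⁺` at an arbitrary position, every antitone weight.**  `E` TTSP between `s, t`, `st ∉ E`, `H = E ∪ {st}`; `S₁ ⊆ H` nonempty, `y ≠ z ∈ H`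
off `S₁`, `N, C ⊆ H` off `S₁ ∪ {y, z}`, `N, S₁, C` pairwise disjoint; `w` antitone; `g` increasing, not reading `S₁ ∪ {y,z}`.  Then, with
`M' = N ∪ {y,z} ∪ S₁` and `f X = 1{S₁ ⊆ X ∧ (y ∈ X ∨ z ∈ X)}`:
`∑_{γ ⊆ M'} w(k(γ∪C)+k((M'\γ)∪C))·(f(γ∪C) − f((M'\γ)∪C))·(g(γ∪C) − g((M'\γ)∪C)) ≤ 0`.
Proof: re-root `H` at an edge of `S₁` and apply `FK.apPsiCW_orAttT_nonpos_of_isTTSP` (file 63f).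
[cite: Grimmett2006, §3.8 Thm. (3.90) (pp. 61–62); §3.9 (pp. 63–64)] [cite: Wagner2006, Thm. 5.8(d), §5.3] -/
theorem apPsiCW_orAttTSet_nonpos_of_isTTSP {E : Finset (Sym2 V)} {s t : V} (hE : IsTTSP E s t) (hst : s(s, t) ∉ E)
    {N S₁ C : Finset (Sym2 V)} {y z : Sym2 V} (hN : N ⊆ insert s(s, t) E) (hS : S₁ ⊆ insert s(s, t) E) (hSne : S₁.Nonempty)
    (hC : C ⊆ insert s(s, t) E) (hy : y ∈ insert s(s, t) E) (hz : z ∈ insert s(s, t) E) (hyz : y ≠ z)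
    (hyN : y ∉ N) (hzN : z ∉ N) (hyS : y ∉ S₁) (hzS : z ∉ S₁) (hyC : y ∉ C) (hzC : z ∉ C)
    (hNS : Disjoint N S₁) (hNC : Disjoint N C) (hSC : Disjoint S₁ C) {w : ℕ → ℝ} (hw : ∀ n : ℕ, w (n + 1) ≤ w n)
    {g : Finset (Sym2 V) → ℝ} (hg : ∀ A U : Finset (Sym2 V), U ⊆ insert y (insert z S₁) → g (A ∪ U) = g A)
    (hmono : ∀ ⦃X Y : Finset (Sym2 V)⦄, X ⊆ Y → g X ≤ g Y) :
    ∑ γ ∈ (N ∪ insert y (insert z S₁)).powerset, w (apExpC (N ∪ insert y (insert z S₁)) C γ) *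
        ((((fun X : Finset (Sym2 V) => if S₁ ⊆ X ∧ (y ∈ X ∨ z ∈ X) then (1 : ℝ) else 0) (γ ∪ C)) -
            ((fun X : Finset (Sym2 V) => if S₁ ⊆ X ∧ (y ∈ X ∨ z ∈ X) then (1 : ℝ) else 0) ((N ∪ insert y (insert z S₁)) \ γ ∪ C))) *
          (g (γ ∪ C) - g ((N ∪ insert y (insert z S₁)) \ γ ∪ C))) ≤ 0 := by
  obtain ⟨e, he⟩ := hSne
  induction e using Sym2.ind with
  | h e₁ e₂ =>
  -- re-root `H` at `e = e₁e₂ ∈ S₁`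
  have hR : IsTTSP ((insert s(s, t) E).erase s(e₁, e₂)) e₁ e₂ :=
    hE.reroot_erase (hS he) (insert_ne_singleton_of_isTTSP hE hst _)
  have heE' : s(e₁, e₂) ∉ (insert s(s, t) E).erase s(e₁, e₂) := Finset.notMem_erase _ _
  have heN : s(e₁, e₂) ∉ N := fun h => Finset.disjoint_left.1 hNS h he
  have heC : s(e₁, e₂) ∉ C := fun h => Finset.disjoint_left.1 hSC he h
  have hey : s(e₁, e₂) ≠ y := fun h => hyS (h ▸ he)
  have hez : s(e₁, e₂) ≠ z := fun h => hzS (h ▸ he)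
  have hN' : N ⊆ (insert s(s, t) E).erase s(e₁, e₂) := fun a ha => Finset.mem_erase.2 ⟨fun h => heN (h ▸ ha), hN ha⟩
  have hT' : S₁.erase s(e₁, e₂) ⊆ (insert s(s, t) E).erase s(e₁, e₂) := Finset.erase_subset_erase _ hS
  have hC' : C ⊆ (insert s(s, t) E).erase s(e₁, e₂) := fun a ha => Finset.mem_erase.2 ⟨fun h => heC (h ▸ ha), hC ha⟩
  have hy' : y ∈ (insert s(s, t) E).erase s(e₁, e₂) := Finset.mem_erase.2 ⟨hey.symm, hy⟩
  have hz' : z ∈ (insert s(s, t) E).erase s(e₁, e₂) := Finset.mem_erase.2 ⟨hez.symm, hz⟩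
  have hyT' : y ∉ S₁.erase s(e₁, e₂) := fun h => hyS (Finset.mem_of_mem_erase h)
  have hzT' : z ∉ S₁.erase s(e₁, e₂) := fun h => hzS (Finset.mem_of_mem_erase h)
  have hNT' : Disjoint N (S₁.erase s(e₁, e₂)) := hNS.mono_right (Finset.erase_subset _ _)
  have hTC' : Disjoint (S₁.erase s(e₁, e₂)) C := hSC.mono_left (Finset.erase_subset _ _)
  have hins : insert s(e₁, e₂) (S₁.erase s(e₁, e₂)) = S₁ := Finset.insert_erase he
  have key := apPsiCW_orAttT_nonpos_of_isTTSP hR heE' hN' hT' hC' hy' hz' hyz hyN hzN hyT' hzT' hyC hzC hNT' hNC hTC' hw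
    (g := g) (fun A U hU => hg A U (by rw [hins] at hU; exact hU)) hmono
  rw [hins] at key
  exact key

/-- **`T1⁺` at an arbitrary position, partial sums by cluster level** (the `T1` rays of the odd-cone assembly, files 64a/64b, in every placement
of the root).  Under the hypotheses of `FK.apPsiCW_orAttTSet_nonpos_of_isTTSP` (no weight), for every level cut-off `J`.
[cite: Grimmett2006, §3.8 Thm. (3.90) (pp. 61–62); §3.9 (pp. 63–64)] [cite: Wagner2006, Thm. 5.8(d), §5.3] -/
theorem apPsiC_levels_le_orAttTSet_nonpos_of_isTTSP {E : Finset (Sym2 V)} {s t : V} (hE : IsTTSP E s t) (hst : s(s, t) ∉ E)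
    {N S₁ C : Finset (Sym2 V)} {y z : Sym2 V} (hN : N ⊆ insert s(s, t) E) (hS : S₁ ⊆ insert s(s, t) E) (hSne : S₁.Nonempty)
    (hC : C ⊆ insert s(s, t) E) (hy : y ∈ insert s(s, t) E) (hz : z ∈ insert s(s, t) E) (hyz : y ≠ z)
    (hyN : y ∉ N) (hzN : z ∉ N) (hyS : y ∉ S₁) (hzS : z ∉ S₁) (hyC : y ∉ C) (hzC : z ∉ C)
    (hNS : Disjoint N S₁) (hNC : Disjoint N C) (hSC : Disjoint S₁ C) (J : ℕ)
    {g : Finset (Sym2 V) → ℝ} (hg : ∀ A U : Finset (Sym2 V), U ⊆ insert y (insert z S₁) → g (A ∪ U) = g A)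
    (hmono : ∀ ⦃X Y : Finset (Sym2 V)⦄, X ⊆ Y → g X ≤ g Y) :
    ∑ γ ∈ (N ∪ insert y (insert z S₁)).powerset with apExpC (N ∪ insert y (insert z S₁)) C γ ≤ J,
        ((((fun X : Finset (Sym2 V) => if S₁ ⊆ X ∧ (y ∈ X ∨ z ∈ X) then (1 : ℝ) else 0) (γ ∪ C)) -
            ((fun X : Finset (Sym2 V) => if S₁ ⊆ X ∧ (y ∈ X ∨ z ∈ X) then (1 : ℝ) else 0) ((N ∪ insert y (insert z S₁)) \ γ ∪ C))) *
          (g (γ ∪ C) - g ((N ∪ insert y (insert z S₁)) \ γ ∪ C))) ≤ 0 := by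
  have key := apPsiCW_orAttTSet_nonpos_of_isTTSP hE hst hN hS hSne hC hy hz hyz hyN hzN hyS hzS hyC hzC hNS hNC hSC
    (w := fun n => if n ≤ J then (1 : ℝ) else 0)
    (fun n => by
      split_ifs with h1 h2 h2
      · exact le_rfl
      · exact absurd ((Nat.le_succ n).trans h1) h2
      · exact zero_le_one
      · exact le_rfl) hg hmono
  rw [Finset.sum_filter]
  refine le_of_eq_of_le (Finset.sum_congr rfl fun γ _ => ?_) key
  split_ifs <;> ring

end FK

end Summit.CriticalPhenomena.PercolationContinuityZ3.Theorems
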